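import Summits.ValiantsHypothesis.ValiantsHypothesis.Theorems.KPlusLogSqLawTropicalBTwoRowFamily
import Summits.ValiantsHypothesis.ValiantsHypothesis.Theorems.KPlusLogSqLawTropicalBHalfThinUnsigned

/-!
# Route «KPlusLogSqLaw», crux `TropicalB` (stmt-ValiantsHypothesis-19771) — the UNSIGNED `m = 2` tropical row is EXACT:
# `T_D(2, K) = 4K − 7` for every `K ≥ 3`

HONEST FRAMING.  Helper toward the registered stubs of the crux `TropicalB` (cell `pub-symmetroid`, seat val-sym-trop-p3 g6, 2026-08-27;
`--supports … --as helper`).  A small-format census row (size `m = 2`, every `K`) in the super-fat corner, far off the window of the crux;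
nothing here bears on `TropicalB` in its window, `WeakLifting`, the doors, `MatrixDescartes` (stmt-ValiantsHypothesis-18050) or VP ≠ VNP.

The signed row is exact in the tree: `T(2,K) = 4K − 7` for `K ≥ 3` (`tropRootLawAt_two_sharp`, val-sym-trop-p4; `not_tropRootLawAt_two_sharp`,
`tropRootLawAt_two_iff`, `…TropicalBTwoRowFamily`).  The UNSIGNED row `TropRowD 2 K ·` (consecutive dominant terms distinct, no sign condition;
`…TropicalBSplitDefs`) stood at `T_D(2,K) ≤ 4K − 3` (`IteratedHalving.tropRowD_two_row`, p505865).  OBSERVATION (same as for the half-thin law,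
`…TropicalBHalfThinUnsigned`): the proof of `tropRootLawAt_two_sharp` uses sign alternation only through the injectivity of the chain
(`stub_dominantInjective`), and an unsigned dominant chain is injective as well (`RefreshExclusivity.chain_ne_of_succ_ne`).  Hence

* `injective_of_succ_ne` — an unsigned dominant chain is injective;
* `tropRowD_two_sharp : 3 ≤ K → TropRowD 2 K (4K − 7)` (proof = `tropRootLawAt_two_sharp` verbatim with the injectivity source swapped;
  the counting is val-sym-trop-p4's: same permutation ⇒ total rank strictly increases, the four extreme total ranks are taken once);
* `not_tropRowD_two_sharp : 3 ≤ K → ¬ TropRowD 2 K (4K − 8)` (the signed family of `…TwoRowFamily` is an unsigned chain);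
* `tropRowD_two_iff : 3 ≤ K → (TropRowD 2 K B ↔ 4K − 7 ≤ B)` — **the unsigned `m = 2` row is exact, `T_D(2,K) = 4K − 7 = T(2,K)`**:
  at size two signs cost nothing (at size three the located unsigned/signed slopes are 10 / 9 per class, val-sym-trop-p3 g5 FINDINGS).
[this cell; counting argument of val-sym-trop-p4]
-/

set_option linter.dupNamespace false
set_option autoImplicit false

namespace Summit.ValiantsHypothesis.ValiantsHypothesis.Theorems.KPlusLogSqLaw

open Summit.ValiantsHypothesis.ValiantsHypothesis.Theorems.MatrixDescartes.Negative
open Summit.ValiantsHypothesis.ValiantsHypothesis.Theorems.LacunarySymmetroidMatrixDescartes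
open Summit.ValiantsHypothesis.ValiantsHypothesis.Theorems.LacunarySymmetroidMatrixDescartes.TropicalCensus
open Finset

variable {K : ℕ}

/-- An UNSIGNED dominant chain (consecutive terms distinct) is injective. [folklore; `RefreshExclusivity.chain_ne_of_succ_ne`] -/
theorem injective_of_succ_ne {m n : ℕ} (d : Fin K → ℕ) (v ε : Fin m → Fin m → Fin K → ℤ) (θ : Fin (n + 1) → ℤ)
    (p : Fin (n + 1) → Equiv.Perm (Fin m) × (Fin m → Fin K)) (hθ : StrictMono θ)
    (hdom : ∀ k, IsDominant d v ε (θ k) (p k)) (hsucc : ∀ k : Fin n, p k.castSucc ≠ p k.succ) :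
    Function.Injective p := by
  intro a b hpab
  rcases lt_trichotomy a b with h | h | h
  · exact absurd hpab (RefreshExclusivity.chain_ne_of_succ_ne d v ε θ p hθ hdom hsucc h)
  · exact h
  · exact absurd hpab.symm (RefreshExclusivity.chain_ne_of_succ_ne d v ε θ p hθ hdom hsucc h)

/-- **Sharp UNSIGNED `m = 2` tropical row**: `T_D(2, K) ≤ 4K − 7` for every `K ≥ 3` — every `2 × 2` dominance design with `K` classes has at
most `4K − 7` breakpoints along a dominant chain with consecutive terms distinct (no sign condition).  Proof: val-sym-trop-p4's
`tropRootLawAt_two_sharp`, with the injectivity of the chain taken from `injective_of_succ_ne`. [this cell; argument of val-sym-trop-p4] -/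
theorem tropRowD_two_sharp (K : ℕ) (hK : 3 ≤ K) : TropRowD 2 K (4 * K - 7) := by
  intro d v ε n θ p hθ hdom hsucc
  have hinj : Function.Injective p := injective_of_succ_ne d v ε θ p hθ hdom hsucc
  -- (1) same permutation ⇒ total rank strictly increases (as in `tropRootLawAt_thin`)
  have hkey : ∀ a b : Fin (n + 1), a < b → (p a).1 = (p b).1 → termRank d (p a) < termRank d (p b) := by
    intro a b hab h1
    have hne : p a ≠ p b := fun h => (ne_of_lt hab) (hinj h)
    have h2 : (p a).2 ≠ (p b).2 := fun h => hne (Prod.ext h1 h)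
    obtain ⟨i, hi⟩ := Function.ne_iff.mp h2
    have hpa : p a = ((p a).1, (p a).2) := rfl
    have hpb : p b = ((p a).1, (p b).2) := by rw [h1]
    have hda : IsDominant d v ε (θ a) ((p a).1, (p a).2) := hpa ▸ hdom a
    have hdb : IsDominant d v ε (θ b) ((p a).1, (p b).2) := hpb ▸ hdom b
    have hmono : ∀ j, dRank d ((p a).2 j) ≤ dRank d ((p b).2 j) := by
      intro j
      by_cases hj : (p a).2 j = (p b).2 j
      · rw [hj]
      · exact (dRank_lt_of_lt d (d_lt_of_dominant d v ε (hθ hab) _ _ _ hda hdb j hj)).le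
    have hstrict : dRank d ((p a).2 i) < dRank d ((p b).2 i) :=
      dRank_lt_of_lt d (d_lt_of_dominant d v ε (hθ hab) _ _ _ hda hdb i hi)
    unfold termRank
    exact sum_lt_sum (fun j _ => hmono j) ⟨i, mem_univ _, hstrict⟩
  have hsame : ∀ a b : Fin (n + 1), (p a).1 = (p b).1 → termRank d (p a) = termRank d (p b) → a = b := by
    intro a b h1 h2
    rcases lt_trichotomy a b with h | h | h
    · exact absurd h2 (ne_of_lt (hkey a b h h1))
    · exact h
    · exact absurd h2.symm (ne_of_lt (hkey b a h h1.symm))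
  -- (2) slopes strictly increase ⇒ an extreme total rank is taken at most once
  have hslope : ∀ a b : Fin (n + 1), a < b → TropicalCensus.slope d (p a) < TropicalCensus.slope d (p b) := by
    intro a b hab
    exact slope_lt_of_dominant d v ε (hθ hab) (fun h => (ne_of_lt hab) (hinj h)) (hdom a) (hdom b)
  have hext : ∀ a b : Fin (n + 1), termRank d (p a) = termRank d (p b) →
      (termRank d (p a) = 0 ∨ termRank d (p a) = 1 ∨ termRank d (p a) = 2 * K - 3 ∨ termRank d (p a) = 2 * K - 2) →
      a = b := by
    intro a b hr hx
    have hs := slope_eq_of_termRank_extreme hK d (p a) (p b) hr hx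
    rcases lt_trichotomy a b with h | h | h
    · exact absurd hs (ne_of_lt (hslope a b h))
    · exact h
    · exact absurd hs.symm (ne_of_lt (hslope b a h))
  -- (3) an explicit injective numbering of the chain by `[0, 4K − 6)`
  have hrank : ∀ k, termRank d (p k) ≤ 2 * K - 2 := by
    intro k
    have := termRank_le d (p k)
    omega
  have hperm2 : ∀ σ τ : Equiv.Perm (Fin 2), σ ≠ 1 → τ ≠ 1 → σ = τ := by decide
  classical
  let sw : Fin (n + 1) → ℕ := fun k => if (p k).1 = 1 then 0 else 1
  have hsw : ∀ k, sw k ≤ 1 := by intro k; simp only [sw]; split_ifs <;> omega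
  have hsw' : ∀ a b, sw a = sw b → (p a).1 = (p b).1 := by
    intro a b h
    simp only [sw] at h
    split_ifs at h with ha hb hb
    · rw [ha, hb]
    · exact hperm2 _ _ ha hb
  let code : Fin (n + 1) → ℕ := fun k =>
    if termRank d (p k) ≤ 1 then termRank d (p k)
    else if 2 * K - 3 ≤ termRank d (p k) then termRank d (p k) + (2 * K - 5)
    else 2 * termRank d (p k) - 2 + sw k
  have hcode_lt : ∀ k, code k < 4 * K - 6 := by
    intro k
    have h1 := hrank k; have h2 := hsw k
    simp only [code]
    split_ifs <;> omega
  have hcode : ∀ a b, code a = code b → termRank d (p a) = termRank d (p b) ∧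
      (termRank d (p a) ≤ 1 ∨ 2 * K - 3 ≤ termRank d (p a) ∨ sw a = sw b) := by
    intro a b h
    have h1 := hrank a; have h2 := hrank b; have h3 := hsw a; have h4 := hsw b
    simp only [code] at h
    split_ifs at h <;> omega
  let f : Fin (n + 1) → Fin (4 * K - 6) := fun k => ⟨code k, hcode_lt k⟩
  have hf : Function.Injective f := by
    intro a b hab
    have h : code a = code b := by
      have := congrArg Fin.val hab
      simpa [f] using this
    obtain ⟨hr, hx⟩ := hcode a b h
    have h1 := hrank a
    rcases hx with hx | hx | hx
    · exact hext a b hr (by omega)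
    · exact hext a b hr (by omega)
    · exact hsame a b (hsw' a b hx) hr
  have hcard := Fintype.card_le_of_injective f hf
  simp only [Fintype.card_fin] at hcard
  omega

/-- **`T_D(2, K) ≥ 4K − 7`** for every `K ≥ 3`: val-sym-trop-p4's sign-alternating family (`not_tropRootLawAt_two_sharp`) is in particular an
unsigned chain. [this cell] -/
theorem not_tropRowD_two_sharp (K : ℕ) (hK : 3 ≤ K) : ¬ TropRowD 2 K (4 * K - 8) :=
  fun h => not_tropRootLawAt_two_sharp K hK (tropRootLawAt_of_tropRowD h)

/-- **The UNSIGNED `m = 2` tropical row is exact: `T_D(2, K) = 4K − 7 = T(2, K)`** (`K ≥ 3`): `TropRowD 2 K B ↔ 4K − 7 ≤ B`.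
At size two signs cost nothing. [this cell] -/
theorem tropRowD_two_iff (K : ℕ) (hK : 3 ≤ K) (B : ℕ) : TropRowD 2 K B ↔ 4 * K - 7 ≤ B := by
  constructor
  · intro h
    by_contra hB
    exact not_tropRowD_two_sharp K hK (tropRowD_mono (by omega) h)
  · intro hB
    exact tropRowD_mono hB (tropRowD_two_sharp K hK)

/-- The unsigned and the signed `m = 2` rows coincide (`K ≥ 3`). [this cell] -/
theorem tropRowD_two_iff_tropRootLawAt_two (K : ℕ) (hK : 3 ≤ K) (B : ℕ) : TropRowD 2 K B ↔ TropRootLawAt 2 K B := by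
  rw [tropRowD_two_iff K hK B, tropRootLawAt_two_iff K hK B]

end Summit.ValiantsHypothesis.ValiantsHypothesis.Theorems.KPlusLogSqLaw
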